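import Literature.Probability.LatticeModels.TorusInverseQuadraticWeightSum
import Literature.Probability.LatticeModels.TorusFourierWeightedL1Prod
import HarnessLib

/-!
# Lattice sums of the inverse ADDITIVE weight `(1 + (s₀|ã|)⁴ + (s₁|b̃₁|)⁴ + (s₂|b̃₂|)⁴)⁻¹` on `(ℤ/N) × (ℤ/L)²`

Topic `Literature/Probability/LatticeModels`; companion of `TorusInverseQuadraticWeightSum.lean` and the geometry-of-the-weight input of
`TorusFourierWeightedL1Prod.sum_sum_norm_prodChar_le` used with SECOND differences (`N = 2`) and the additive weight
`W(a,b) = 1 + c₀(4|ã|/N)⁴ + Σ_i c_i(4|b̃_i|/L)⁴` — no mixed differences of the symbol are then needed, at the price of a weight that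
does not factorise.  Its inverse is still summable uniformly in the lattice sizes because `Σ 1/(2·2) = 3/4 < 1` (anisotropic
integrability), and the sum is reduced to one-dimensional ones by the arithmetic–geometric mean inequality
`(1+u+v+w)⁻¹ ≤ (1+u)^{-1/3}(1+v)^{-1/3}(1+w)^{-1/3}` and the elementary bound `(1+y⁴)^{-1/3} ≤ 2(1+y)^{-4/3}`:

* `inv_one_add_three_le_rpow_prod` — the AM–GM step;
* `rpow_one_add_pow_four_le` — `(1+y⁴)^{-1/3} ≤ 2(1+y)^{-4/3}` (`y ≥ 0`);
* `sum_range_rpow_one_add_mul_le` — `Σ_{i<K} 2(1+s(i+1))^{-4/3} ≤ 6/s` (antitone sum ≤ integral);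
* `sum_zmod_rpow_one_add_valMinAbs_pow_four_le` — `Σ_{x ∈ ℤ/n} (1 + (s|x̃|)⁴)^{-1/3} ≤ 2 + 12/s`;
* **`sum_inv_additiveWeight_le`** — `Σ_{(a,b) ∈ (ℤ/N)¹×(ℤ/L)²} W⁻¹ ≤ (2 + 12/s₀)(2 + 12/s₁)(2 + 12/s₂)`, i.e. `≲ (N/c₀^{1/4})(L/c₁^{1/4})(L/c₂^{1/4})`
  lattice points in the decay box (Benfatto–Giuliani–Mastropietro 2006, Lemma 2.2 at finite `(β, L)`: the `L¹` norm of a single-scale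
  propagator is its sup times its decay volume; cell gate-hubbard-kl, R0-SCOPE-4 W2b).

Everything is proved; no definitions, no named facts.

## Sources

G. Benfatto, A. Giuliani, V. Mastropietro, Ann. Henri Poincaré 7 (2006) 809–898, Lemma 2.2 and footnote ¹
(`BenfattoGiulianiMastropietro2006`); S. Friedli, Y. Velenik, *Statistical Mechanics of Lattice Systems* (2017), §10.4 (`FriedliVelenik2017`).
-/

noncomputable section

open Finset Real MeasureTheory intervalIntegral

namespace Literature.Probability.LatticeModels

/-! ### Two elementary inequalities -/

/-- **AM–GM for the inverse additive weight**: `(1+u+v+w)⁻¹ ≤ (1+u)^{-1/3}(1+v)^{-1/3}(1+w)^{-1/3}` for `u, v, w ≥ 0`.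
[cite: FriedliVelenik2017, §10.4] -/
theorem inv_one_add_three_le_rpow_prod {u v w : ℝ} (hu : 0 ≤ u) (hv : 0 ≤ v) (hw : 0 ≤ w) :
    (1 + u + v + w)⁻¹ ≤ (1 + u) ^ (-(1 / 3 : ℝ)) * (1 + v) ^ (-(1 / 3 : ℝ)) * (1 + w) ^ (-(1 / 3 : ℝ)) := by
  have hgm := Real.geom_mean_le_arith_mean3_weighted (w₁ := 1 / 3) (w₂ := 1 / 3) (w₃ := 1 / 3) (p₁ := 1 + u) (p₂ := 1 + v)
    (p₃ := 1 + w) (by norm_num) (by norm_num) (by norm_num) (by linarith) (by linarith) (by linarith) (by norm_num)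
  have hprod_pos : 0 < (1 + u) ^ (1 / 3 : ℝ) * (1 + v) ^ (1 / 3 : ℝ) * (1 + w) ^ (1 / 3 : ℝ) := by positivity
  have hle : (1 + u) ^ (1 / 3 : ℝ) * (1 + v) ^ (1 / 3 : ℝ) * (1 + w) ^ (1 / 3 : ℝ) ≤ 1 + u + v + w := by
    refine hgm.trans ?_
    nlinarith
  rw [Real.rpow_neg (by linarith), Real.rpow_neg (by linarith), Real.rpow_neg (by linarith), ← mul_inv, ← mul_inv]
  exact inv_anti₀ hprod_pos hle

/-- **`(1+y⁴)^{-1/3} ≤ 2(1+y)^{-4/3}`** for `y ≥ 0` (since `(1+y)⁴ ≤ 8(1+y⁴)`). [cite: FriedliVelenik2017, §10.4] -/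
theorem rpow_one_add_pow_four_le {y : ℝ} (hy : 0 ≤ y) :
    (1 + y ^ 4) ^ (-(1 / 3 : ℝ)) ≤ 2 * (1 + y) ^ (-(4 / 3 : ℝ)) := by
  have h8 : (1 + y) ^ 4 / 8 ≤ 1 + y ^ 4 := by
    nlinarith [sq_nonneg (y - 1), sq_nonneg (y + 1), sq_nonneg (y ^ 2 - 1), mul_nonneg hy (sq_nonneg (y - 1)),
      mul_nonneg (mul_nonneg hy hy) (sq_nonneg (y - 1))]
  have hpos : 0 < (1 + y) ^ 4 / 8 := by positivity
  have h1 : (1 + y ^ 4) ^ (-(1 / 3 : ℝ)) ≤ ((1 + y) ^ 4 / 8) ^ (-(1 / 3 : ℝ)) :=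
    Real.rpow_le_rpow_of_nonpos hpos h8 (by norm_num)
  refine h1.trans (le_of_eq ?_)
  rw [Real.div_rpow (by positivity) (by norm_num), show ((1 + y) ^ 4 : ℝ) = (1 + y) ^ ((4 : ℕ) : ℝ) by
    rw [Real.rpow_natCast], ← Real.rpow_mul (by linarith), show ((4 : ℕ) : ℝ) * -(1 / 3 : ℝ) = -(4 / 3 : ℝ) by norm_num]
  have h8r : (8 : ℝ) ^ (-(1 / 3 : ℝ)) = 1 / 2 := by
    rw [Real.rpow_neg (by norm_num), show (8 : ℝ) = 2 ^ (3 : ℕ) by norm_num, show (1 / 3 : ℝ) = ((3 : ℕ) : ℝ)⁻¹ by norm_num,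
      Real.pow_rpow_inv_natCast (by norm_num) (by norm_num)]
    norm_num
  rw [h8r]
  ring

/-! ### The one-dimensional sums -/

/-- **The integer sum**: `Σ_{i < K} 2(1 + s(i+1))^{-4/3} ≤ 6/s` for `s > 0` (the antitone function `x ↦ 2(1+sx)^{-4/3}` against its
integral `∫_0^K = (6/s)(1 - (1+sK)^{-1/3}) ≤ 6/s`). [cite: FriedliVelenik2017, §10.4] -/
theorem sum_range_rpow_one_add_mul_le {s : ℝ} (hs : 0 < s) (K : ℕ) :
    ∑ i ∈ range K, 2 * (1 + s * ((i : ℝ) + 1)) ^ (-(4 / 3 : ℝ)) ≤ 6 / s := by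
  set f : ℝ → ℝ := fun x => 2 * (1 + s * x) ^ (-(4 / 3 : ℝ)) with hf
  have hanti : AntitoneOn f (Set.Icc (0 : ℝ) (0 + K)) := by
    intro x hx y _ hxy
    simp only [hf]
    have hx0 : 0 ≤ x := hx.1
    refine mul_le_mul_of_nonneg_left (Real.rpow_le_rpow_of_nonpos (by positivity) (by nlinarith) (by norm_num)) (by norm_num)
  have hsum := AntitoneOn.sum_le_integral hanti
  simp only [hf, zero_add] at hsum
  have hcast : ∑ i ∈ range K, 2 * (1 + s * ((i : ℝ) + 1)) ^ (-(4 / 3 : ℝ)) =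
      ∑ i ∈ range K, 2 * (1 + s * ((i + 1 : ℕ) : ℝ)) ^ (-(4 / 3 : ℝ)) := by
    refine sum_congr rfl fun i _ => ?_
    push_cast
    ring_nf
  rw [hcast]
  refine hsum.trans ?_
  -- `∫_0^K 2(1+sx)^{-4/3} dx = s⁻¹ ∫_1^{1+sK} 2 y^{-4/3} dy = (6/s)(1 - (1+sK)^{-1/3})`
  have hcomp : ∫ x in (0 : ℝ)..(K : ℝ), 2 * (1 + s * x) ^ (-(4 / 3 : ℝ)) =
      s⁻¹ * ∫ y in (1 : ℝ)..(s * K + 1), 2 * y ^ (-(4 / 3 : ℝ)) := by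
    have := intervalIntegral.integral_comp_mul_add (fun y : ℝ => 2 * y ^ (-(4 / 3 : ℝ))) hs.ne' (1 : ℝ) (a := 0) (b := K)
    simp only [mul_zero, zero_add, smul_eq_mul] at this
    rw [← this]
    refine intervalIntegral.integral_congr fun x _ => ?_
    simp only [add_comm (1 : ℝ) (s * x)]
  have hK0 : (0 : ℝ) ≤ s * K := by positivity
  have hrpow : ∫ y in (1 : ℝ)..(s * K + 1), y ^ (-(4 / 3 : ℝ)) =
      ((s * K + 1) ^ (-(4 / 3 : ℝ) + 1) - 1 ^ (-(4 / 3 : ℝ) + 1)) / (-(4 / 3 : ℝ) + 1) := by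
    refine integral_rpow (Or.inr ⟨by norm_num, ?_⟩)
    rw [Set.uIcc_of_le (by linarith)]
    exact fun h => by linarith [h.1]
  rw [hcomp, intervalIntegral.integral_const_mul, hrpow, Real.one_rpow]
  have hpow0 : 0 ≤ (s * K + 1) ^ (-(4 / 3 : ℝ) + 1) := by positivity
  have hval : s⁻¹ * (2 * (((s * ↑K + 1) ^ (-(4 / 3 : ℝ) + 1) - 1) / (-(4 / 3 : ℝ) + 1))) =
      6 / s * (1 - (s * ↑K + 1) ^ (-(4 / 3 : ℝ) + 1)) := by
    field_simp
    ring
  rw [hval]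
  have h6 : 0 < 6 / s := by positivity
  nlinarith

/-- **The lattice sum on `ℤ/nℤ`**: `Σ_{x ∈ ℤ/nℤ} (1 + (s|x̃|)⁴)^{-1/3} ≤ 2 + 12/s` for `s > 0` (`x̃` the centred representative; every value
`k = |x̃|` is taken at most twice, `(1+(sk)⁴)^{-1/3} ≤ 2(1+sk)^{-4/3}`). [cite: BenfattoGiulianiMastropietro2006, Lemma 2.2 and footnote 1] -/
theorem sum_zmod_rpow_one_add_valMinAbs_pow_four_le {n : ℕ} [NeZero n] {s : ℝ} (hs : 0 < s) :
    ∑ x : ZMod n, (1 + (s * |((x.valMinAbs : ℤ) : ℝ)|) ^ 4) ^ (-(1 / 3 : ℝ)) ≤ 2 + 12 / s := by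
  classical
  set φ : ZMod n → ℕ := fun x => x.valMinAbs.natAbs with hφ
  set g : ℕ → ℝ := fun k => (1 + (s * (k : ℝ)) ^ 4) ^ (-(1 / 3 : ℝ)) with hg
  have hg0 : ∀ k, 0 ≤ g k := fun k => by rw [hg]; positivity
  have hterm : ∀ x : ZMod n, (1 + (s * |((x.valMinAbs : ℤ) : ℝ)|) ^ 4) ^ (-(1 / 3 : ℝ)) = g (φ x) := by
    intro x
    simp only [hg, hφ, Nat.cast_natAbs, Int.cast_abs]
  simp_rw [hterm]
  set T : Finset ℕ := range (n / 2 + 1) with hT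
  have hmaps : ∀ x ∈ (univ : Finset (ZMod n)), φ x ∈ T := fun x _ => by
    rw [hT, mem_range, Nat.lt_succ_iff]
    exact ZMod.natAbs_valMinAbs_le x
  rw [← sum_fiberwise_of_maps_to hmaps]
  have hfib : ∀ k ∈ T, ∑ x ∈ univ.filter (fun x : ZMod n => φ x = k), g (φ x) ≤ 2 * g k := by
    intro k _
    have hcard : ((univ.filter fun x : ZMod n => φ x = k).card : ℝ) ≤ 2 := by
      have hinj : Set.InjOn (fun x : ZMod n => x.valMinAbs) (univ.filter fun x : ZMod n => φ x = k) :=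
        fun x _ y _ hxy => ZMod.valMinAbs_inj.1 hxy
      have hmt : ∀ x ∈ univ.filter (fun x : ZMod n => φ x = k), x.valMinAbs ∈ ({(k : ℤ), -(k : ℤ)} : Finset ℤ) := by
        intro x hx
        have hk : x.valMinAbs.natAbs = k := (mem_filter.1 hx).2
        rw [mem_insert, mem_singleton]
        rcases Int.natAbs_eq x.valMinAbs with h | h
        · left; rw [h, hk]
        · right; rw [h, hk]
      have h := card_le_card_of_injOn _ hmt hinj
      have h2 : (({(k : ℤ), -(k : ℤ)} : Finset ℤ).card) ≤ 2 := card_insert_le _ _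
      exact_mod_cast h.trans h2
    calc ∑ x ∈ univ.filter (fun x : ZMod n => φ x = k), g (φ x)
        = ∑ x ∈ univ.filter (fun x : ZMod n => φ x = k), g k :=
          sum_congr rfl fun x hx => by rw [(mem_filter.1 hx).2]
      _ = (univ.filter fun x : ZMod n => φ x = k).card * g k := by rw [sum_const, nsmul_eq_mul]
      _ ≤ 2 * g k := mul_le_mul_of_nonneg_right hcard (hg0 k)
  refine (sum_le_sum hfib).trans ?_
  rw [← mul_sum, hT, sum_range_succ']
  have h0 : g 0 = 1 := by simp only [hg, Nat.cast_zero, mul_zero]; norm_num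
  have htail : ∑ i ∈ range (n / 2), g (i + 1) ≤ 6 / s := by
    refine le_trans (sum_le_sum fun i _ => ?_) (sum_range_rpow_one_add_mul_le hs (n / 2))
    simp only [hg, Nat.cast_add, Nat.cast_one]
    exact rpow_one_add_pow_four_le (by positivity)
  rw [h0]
  calc 2 * (∑ i ∈ range (n / 2), g (i + 1) + 1) ≤ 2 * (6 / s + 1) :=
        mul_le_mul_of_nonneg_left (add_le_add htail le_rfl) (by norm_num)
    _ = 2 + 12 / s := by ring

/-! ### The three-dimensional sum -/

/-- **The inverse additive weight is summable uniformly in the lattice sizes**: for rates `s₀, s₁, s₂ > 0`,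
`Σ_{a ∈ (ℤ/N)¹} Σ_{b ∈ (ℤ/L)²} (1 + (s₀|ã|)⁴ + (s₁|b̃₁|)⁴ + (s₂|b̃₂|)⁴)⁻¹ ≤ (2 + 12/s₀)(2 + 12/s₁)(2 + 12/s₂)`
(`≍` the number of lattice points in the box `|ã| ≲ 1/s₀, |b̃_i| ≲ 1/s_i`). [cite: BenfattoGiulianiMastropietro2006, Lemma 2.2 and footnote 1] -/
theorem sum_inv_additiveWeight_le {N L : ℕ} [NeZero N] [NeZero L] {s₀ : ℝ} (hs₀ : 0 < s₀) (t : Fin 2 → ℝ) (ht : ∀ i, 0 < t i) :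
    ∑ a : TorusSite 1 N, ∑ b : TorusSite 2 L,
        (1 + (s₀ * |(((a 0).valMinAbs : ℤ) : ℝ)|) ^ 4 + ∑ i, (t i * |(((b i).valMinAbs : ℤ) : ℝ)|) ^ 4)⁻¹ ≤
      (2 + 12 / s₀) * ∏ i, (2 + 12 / t i) := by
  -- AM–GM pointwise, then the sums factorise
  have hpt : ∀ (a : TorusSite 1 N) (b : TorusSite 2 L),
      (1 + (s₀ * |(((a 0).valMinAbs : ℤ) : ℝ)|) ^ 4 + ∑ i, (t i * |(((b i).valMinAbs : ℤ) : ℝ)|) ^ 4)⁻¹ ≤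
        (1 + (s₀ * |(((a 0).valMinAbs : ℤ) : ℝ)|) ^ 4) ^ (-(1 / 3 : ℝ)) *
          ∏ i, (1 + (t i * |(((b i).valMinAbs : ℤ) : ℝ)|) ^ 4) ^ (-(1 / 3 : ℝ)) := by
    intro a b
    rw [Fin.sum_univ_two, Fin.prod_univ_two, ← add_assoc, ← mul_assoc]
    exact inv_one_add_three_le_rpow_prod (by positivity) (by positivity) (by positivity)
  refine (sum_le_sum fun a _ => sum_le_sum fun b _ => hpt a b).trans ?_
  simp_rw [← mul_sum, ← sum_mul]
  refine mul_le_mul ?_ ?_ (sum_nonneg fun b _ => prod_nonneg fun i _ => by positivity) (by positivity)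
  · -- the time direction: `(ℤ/N)¹ ≃ ℤ/N`
    rw [show (∑ a : TorusSite 1 N, (1 + (s₀ * |(((a 0).valMinAbs : ℤ) : ℝ)|) ^ 4) ^ (-(1 / 3 : ℝ))) =
        ∑ z : ZMod N, (1 + (s₀ * |((z.valMinAbs : ℤ) : ℝ)|) ^ 4) ^ (-(1 / 3 : ℝ)) from
      Fintype.sum_equiv (Equiv.funUnique (Fin 1) (ZMod N)) _ _ fun a => rfl]
    exact sum_zmod_rpow_one_add_valMinAbs_pow_four_le hs₀
  · -- the two space directions factorise
    rw [← Fintype.piFinset_univ, ← Finset.prod_univ_sum (fun _ : Fin 2 => (univ : Finset (ZMod L)))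
      fun i (z : ZMod L) => (1 + (t i * |((z.valMinAbs : ℤ) : ℝ)|) ^ 4) ^ (-(1 / 3 : ℝ))]
    exact prod_le_prod (fun i _ => sum_nonneg fun z _ => by positivity)
      fun i _ => sum_zmod_rpow_one_add_valMinAbs_pow_four_le (ht i)

end Literature.Probability.LatticeModels

end
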